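import Literature.MathematicalPhysics.QuantumFieldTheory.Balaban1983to89.Node00.CarriersB8SubBP
import Literature.MathematicalPhysics.QuantumFieldTheory.Balaban1983to89.B8LeafModelZd3P2
import Literature.MathematicalPhysics.QuantumFieldTheory.Balaban1983to89.B8LeafKnitRSC
import Literature.MathematicalPhysics.QuantumFieldTheory.Balaban1983to89.B8Prop7TowerAxialRecordP

/-!
# NODE 00 (YM-PLAN Track A) — STAGE 3′(X.B8″P₂C): THE «P₂C» RE-PIN OF THE [Balaban1985RegularSpaces] SUB-FAMILY — the [B8] group of record over the ADMISSIBLE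
# sub-index `IdxB8SubC θ := {j : IdxB8SubB θ ∕∕ DomainSeq θ.L j.1.1.Ω}` (print's (1.3)–(1.4) AS TYPED), members read at the edition-δ₂ carrier `B8LeafModelZd3P2.zdGF3HP₂`
# (the Hölder member of (1.36) on print's both-points class), the surviving leaf over it IN THE `Prop7RepairedC C₇` CURRENCY (`B8LeafKnitRSC.B8LeafRSC`,
# `C₇ := 530·θ.D·θ.L²`) WITH PROPOSITION 7's AXIAL MAP PINNED to print's tower-wise map `toAxialTowerResid` — so that the `p7` conjunct is SERVED BY A TREE THEOREM
# (`B8Prop7TowerAxialRecordP`, by name) at every member; its reading, the carrier laws, and the cut layer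

[Balaban1985RegularSpaces] = T. Bałaban, *Spaces of regular gauge field configurations on a lattice and gauge fixing conditions*, Commun. Math. Phys. **99**
(1985) 75–102 — Lemma 1 p. 79, Thm 2 p. 83, Prop. 3 p. 87, Thm 4 p. 88, Props. 5–7 pp. 94–100, Thm 8 p. 101; (1.3)–(1.6) p. 77, (1.31) ∕ (1.35) ∕ (1.36) ∕ (1.37) p. 82,
(1.42) p. 83, (1.66) p. 88, (1.139)–(1.145) p. 100, (1.146) p. 101.  PDF held: `paper:balaban1985-cmp99-regular-spaces-gauge-fixing`.
[Balaban1985BackgroundPropagators] (3.40) p. 397 (the Hölder seminorm on a domain: both points in it).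

## WHY THIS FILE (cell `pub-ymgap`, HUMAN RULING D-0062; width seat `pub-ymgap-dag-n05-w1` g0 = the P-pin's author; definition lane, count-neutral)

dag-n05-d g11 DESIGN «P₂C» (cell bus 2026-08-28 03:12Z; words: n05-w1 03:13Z amendment (i), n05-d 03:17Z agreed, n05-e 03:1xZ): the P-slot of record
`CarriersB8SubBP.B8LeafOfRecordSubBP θ λ` (this seat, p592605) has THREE located mismatches with the only honest Proposition-7 supplier
(`B8Prop7TowerAxialRecordP`, p600262): (i) INDEX — the supplier lives on the members obeying print's domain law (1.3)–(1.4), the slot ranges over ALL of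
`IdxB8SubB θ` (where the collar hypothesis is believed to fail at lawful `ρ = 0` members, n05-w2 LOCATED-COLLAR-FORALL); (ii) CURRENCY — the supplier gives
`B8Ineq145.Prop7RepairedC (530·D·L²)`, the slot's leaf `B8LeafRS` reads `B8SectGH.Prop7PrintedR` (constant `2α₂`; no bridge `RepairedC → PrintedR` exists);
(iii) AXIAL MAP — the slot reads the layer's FREE field `λ.toAxial` (junk-inhabitable), the supplier is print's tower-wise map.  ONE re-pin repairs all three:
index `IdxB8SubC θ` (amendment (i): the EXISTING predicate `B8ConstraintBonds.DomainSeq θ.L ·.Ω`, strictly stronger than the axis collar in `d ≥ 2` and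
faithful to print's cube condition), leaf `B8LeafKnitRSC.B8LeafRSC … C₇ …` (n05-d g11, p6xxxxx) at `C₇ := c₇OfRecord θ = 530·θ.D·θ.L²`, axial map
`fun j => toAxialTowerResid θ λ.β λ.len j.1.1`, members `zdGF3HP₂` (edition δ₂, n05-d p599986, so that the both-points b9 socket of N06 is consumable by name).
RESULT (§3): the slot's `p7` conjunct is DISCHARGED here once and for all (`prop7_famB8OfRecordSubBP₂C`, by name from p600262 v1.1 through n05-d's
`prop7RepairedC_zdGF3HP₂_iff`-type `rfl` transport), and the constructor `b8LeafOfRecordSubBP₂C_of_fields` takes the EIGHT remaining conjuncts only.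
PATTERN: this seat's `CarriersB8SubBP` letter for letter (which was n05-c g6's `CarriersB8SubBH` pattern); nothing of NODE 00's record is edited — additive defs.

## WHAT THIS FILE DECLARES (defs + `rfl` ∕ `Iff.rfl` bookkeeping + ONE by-name instance; 0 `sorry`; axioms ⊆ {propext, Classical.choice, Quot.sound})

§1 `IdxB8SubC θ` (+ `nonempty_idxB8SubC`; PROPER by n05-w2's `B8IdxB8SubBCollarVacuity.not_forall_idxB8SubB_domainSeq`, p602320 — cited, not restated; projections `IdxB8SubC.domainSeq ∕ .Ω_zero ∕ .laws ∕ .collar`), `c₇OfRecord θ`, **`famB8OfRecordSubBP₂C θ β len : IdxB8SubC θ →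
GFData3 := fun j => zdGF3HP₂ θ.𝔸 θ.L β len j.1.1.1`**, its `rfl` faces against `zdGF3P₂` ∕ the P-pin ∕ the H-pin, the two carrier laws (`proj140_…`, `C136_C162_…`).
§2 `PrintedCarriersR.withB8OfRecordSubBP₂C X θ λ` (bundle: `I8b := IdxB8SubC θ`, `fam8 := (famB8OfRecordSubBP₂C …).toGFData2`, `toAxial8 :=` PRINT'S MAP), **`B8LeafOfRecordSubBP₂C θ λ`**
(the slot: `B8LeafRSC` at `c₇OfRecord θ` over the admissible sub-family with the pinned map), `b8LeafRSC_withB8OfRecordSubBP₂C_iff` (`Iff.rfl`), the `rfl` commuting faces.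
§3 THE READING `b8LeafOfRecordSubBP₂C_iff_classFree_and_P₂C`; ★ `prop7_famB8OfRecordSubBP₂C` (the `p7` conjunct PROVED, `θ.D ≥ 2`); ★ `b8LeafOfRecordSubBP₂C_of_fields`
(EIGHT hypotheses: `l1 t2 p3 t4 p5e p5u p6 t8` — no `p7`); projections `.t8HP₂ ∕ .p3P₂ ∕ .t4P₂ ∕ .t2P₂ ∕ .p7C`; `b8LeafOfRecordSubBP₂C_of_b8LeafRS_pinned` (RS-currency leaf over the
SAME pinned data ⇒ the slot, `C₇ ≥ 2`).  §4 the cut layer `λ.cutSubB J lan c₁` faces.  (The source-reading facts of `CarriersB8SubBP` §5 hold verbatim at `j.1`: `InR` is unchanged.)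

## HONEST SCOPE

THE SLOT ASKS LESS THAN PRINT'S PROPOSITION 7 AS TYPED: (1.145) at `C₇·α₂ = 530·θ.D·θ.L²·α₂` instead of `2α₂` (ref-A g26 WATCH-P7-CURRENCY-RECORD, bus l.28393:
a statement-of-record WEAKENING of N05's `p7`, to be BOOKED by the planners ∕ node00-def with the constant displayed; consumers of `p7` must be threshold-existential
in `α₂`) — declared, not hidden.  Definitions and bookkeeping plus ONE by-name Proposition-7 instance (threshold `cst∕L²`); NO other estimate; the
eight remaining conjuncts are the knits' (n05-d D9₂ ∕ n05-w2 δ₂ twins ∕ n05-e cut faces), modulo the [4]-type sockets; whether NODE 00's records bind THIS slot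
(`upOfRecord₅CS`-type constructor in the `B8LeafRSC` currency, the ₁₃ storeys) is the next files' ∕ the planners' business (K1⁷ host), not this file's; N05 NOT
discharged; counts unmoved; one finite T⁴ programme at fixed ε, Bałaban as printed — NOT continuum ∕ ℝ⁴ ∕ infinite volume ∕ OS ∕ mass gap ∕ Clay.  No `sorry`,
no `axiom`, no `opaque`, no `instance`, no `notation`. -/

noncomputable section

namespace Literature.MathematicalPhysics.QuantumFieldTheory.Balaban1983to89.Node00

open DagBinding
open B8LeafKnitRS (B8LeafRS)
open B8LeafKnitRSC (B8LeafRSC)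
open B8LeafModelZd (ZdIdx)
open B8LeafModelZd3 (zdGF3)
open B8LeafModelZd3H (zdGF3H)
open B8LeafModelZd3P (zdGF3P zdGF3HP EndBlockIn)
open B8LeafModelZd3P2 (zdGF3P₂ zdGF3HP₂)
open B8Lemma1NonAbelian (blockPairNA)
open B8IdxB8LawsB (IdxB8LawsB IdxB8SubB famB8OfRecordSubB)
open B8ConstraintBonds (DomainSeq)
open B7Prop1Local (InBox loK bondHiK)
open B8Prop7TowerAxialRecord (toAxialTowerResid)
open B8Prop7TowerAxialRecordP (prop7RepairedC_famB8OfRecordSubBP_toAxialTower_domainSeq nonempty_idxB8SubB_domainSeq)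
open B8Prop7TowerAxialAdmissible (collar_of_domainSeq')

/-! ## §1. The admissible sub-index, the constant `C₇` of record, the [B8] sub-family READ AT THE δ₂-MEMBERS; `rfl` faces; the two carrier laws -/

section FamilyP₂C

variable (θ : Stage3Params)

/-- **THE ADMISSIBLE SUB-INDEX OF RECORD** `IdxB8SubC θ`: the members `j` of n05-c's four-law sub-index `IdxB8SubB θ` (`Ω₀ = ℤᵈ`, located laws №7 ∕ №8 ∕ №11 ∕ №12)
whose Ω-tower is a sequence of domains in print's sense (1.3)–(1.4) — `B8ConstraintBonds.DomainSeq θ.L j.1.1.Ω` (`anti` ∕ `sat` ∕ `sep`), the tree's typed record of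
«Ω_{j+1} ⊂ Ω_j, unions of big blocks, with the collar condition».  A PROPER sub-family (n05-w2 g2's `B8IdxB8SubBCollarVacuity.not_forall_idxB8SubB_domainSeq`:
a lawful width-0 member is not admissible) — which is why the slot is RE-INDEXED rather than the law displayed over all of `IdxB8SubB θ`. [cite: Balaban1985RegularSpaces, (1.3)–(1.6) p.77] -/
def IdxB8SubC : Type :=
  {j : IdxB8SubB θ // DomainSeq θ.L j.1.1.Ω}

/-- **A6 — the admissible sub-index is inhabited at every `θ`** (print's nested tower `(T, □₁)`; n05-w2 g2's `exists_idxB8SubB_domainSeq_topCube` read as `Nonempty` in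
`B8Prop7TowerAxialRecordP.nonempty_idxB8SubB_domainSeq`, by name). [cite: Balaban1985RegularSpaces, (1.131) p.99, (1.3)–(1.4) p.77] -/
theorem nonempty_idxB8SubC : Nonempty (IdxB8SubC θ) :=
  nonempty_idxB8SubB_domainSeq θ

/-- **THE CONSTANT `C₇` OF RECORD** in Proposition 7's repaired currency: `530·θ.D·θ.L²` (the tree's crude witness for print's `2`; `B8Prop7TowerAxialCollarP`).
[cite: Balaban1985RegularSpaces, Prop. 7 (1.145) p.100 (constant: audit G-adv8-16 ∕ `B8Ineq145`)] -/
def c₇OfRecord : ℝ :=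
  530 * (θ.D : ℝ) * (θ.L : ℝ) ^ 2

/-- `c₇OfRecord θ = 530·θ.D·θ.L²` (`rfl`). [cite: Balaban1985RegularSpaces, Prop. 7 (1.145) p.100 (bookkeeping)] -/
theorem c₇OfRecord_eq : c₇OfRecord θ = 530 * (θ.D : ℝ) * (θ.L : ℝ) ^ 2 := rfl

/-- `2 ≤ c₇OfRecord θ` (`θ.D ≥ 1`, `θ.L ≥ 2`): the repaired currency at the constant of record is WEAKER than print's (`B8LeafKnitRSC.b8LeafRSC_of_b8LeafRS` applies).
[cite: Balaban1985RegularSpaces, Prop. 7 (1.145) p.100 (bookkeeping)] -/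
theorem two_le_c₇OfRecord (hD : 1 ≤ θ.D) : 2 ≤ c₇OfRecord θ := by
  have hD' : (1 : ℝ) ≤ θ.D := by exact_mod_cast hD
  have hL' : (2 : ℝ) ≤ θ.L := by exact_mod_cast θ.two_le_L
  unfold c₇OfRecord
  nlinarith [mul_le_mul hD' hL' (by norm_num) (by linarith), sq_nonneg ((θ.L : ℝ) - 2)]

/-- **THE [B8] SUB-FAMILY OF RECORD AT THE δ₂-MEMBERS OVER THE ADMISSIBLE SUB-INDEX**: member `j ↦ zdGF3HP₂ θ.𝔸 θ.L β len j.1.1.1` — this seat's P-member with the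
Hölder member of (1.36) read on print's both-points class (n05-d g11's edition δ₂); every other carrier and predicate of the member unchanged.
[cite: Balaban1985RegularSpaces, (1.31) p.82, (1.35) p.82, (1.36) p.82, (1.37) p.82, (1.42) p.83, (1.66) p.88, p.77, Thm 8 (1.146) p.101; Balaban1985BackgroundPropagators, (3.40) p.397] -/
def famB8OfRecordSubBP₂C (β : ℝ) (len : B7Prop1Explicit.Site θ.D → ℝ) (j : IdxB8SubC θ) : B8SectGH.GFData3 :=
  zdGF3HP₂ θ.𝔸 θ.L β len j.1.1.1

variable {θ}

/-- The member's domain law (1.3)–(1.4) (the subtype's predicate). [cite: Balaban1985RegularSpaces, (1.3)–(1.4) p.77] -/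
theorem IdxB8SubC.domainSeq (j : IdxB8SubC θ) : DomainSeq θ.L j.1.1.1.Ω := j.2

/-- The member's `Ω₀ = ℤᵈ` («we admit Ω_j = T_η», p. 77). [cite: Balaban1985RegularSpaces, p.77] -/
theorem IdxB8SubC.Ω_zero (j : IdxB8SubC θ) : j.1.1.1.Ω 0 = Set.univ := j.1.1.2

/-- The member's four located laws (n05-c's `IdxB8LawsB`). [cite: Balaban1985RegularSpaces, (1.5)–(1.6) p.77, p.98] -/
theorem IdxB8SubC.laws (j : IdxB8SubC θ) : IdxB8LawsB θ.L j.1.1.1 := j.1.2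

/-- **The (1.4) axis collar at an admissible member** (n05-w2 g2's `collar_of_domainSeq'`, by name): the two-block box of a level-`l` bond with an end block in `Ω_l`
lies in `Ω_{l−1}`. [cite: Balaban1985RegularSpaces, (1.3)–(1.4) p.77, p.77 (bond convention)] -/
theorem IdxB8SubC.collar (j : IdxB8SubC θ) :
    ∀ l, l ≤ j.1.1.1.k → ∀ (z : B7Prop1Explicit.Site θ.D) (μ : Fin θ.D), EndBlockIn θ.L (j.1.1.1.Ω l) l z μ →
      ∀ x, InBox (loK θ.L l z) (bondHiK θ.L l z μ) x → x ∈ j.1.1.1.Ω (l - 1) :=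
  collar_of_domainSeq' (le_trans one_le_two θ.two_le_L) j.1.1.1 j.1.1.2 j.2

/-- The δ₂-member unfolded (`rfl`). [cite: Balaban1985RegularSpaces, p.77 (bookkeeping)] -/
theorem famB8OfRecordSubBP₂C_eq (β : ℝ) (len : B7Prop1Explicit.Site θ.D → ℝ) (j : IdxB8SubC θ) :
    famB8OfRecordSubBP₂C θ β len j = zdGF3HP₂ θ.𝔸 θ.L β len j.1.1.1 := rfl

/-- The δ₂-member's `GFData2` part IS `zdGF3P₂`'s (`rfl`). [cite: Balaban1985RegularSpaces, (1.33)–(1.40) pp.82–83 (bookkeeping)] -/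
theorem famB8OfRecordSubBP₂C_toGFData2 (β : ℝ) (len : B7Prop1Explicit.Site θ.D → ℝ) (j : IdxB8SubC θ) :
    (famB8OfRecordSubBP₂C θ β len j).toGFData2 = (zdGF3P₂ θ.𝔸 θ.L β len j.1.1.1).toGFData2 := rfl

/-- The δ₂-member's `GFData` part IS `zdGF3P₂`'s (`rfl`). [cite: Balaban1985RegularSpaces, (1.33)–(1.39) p.82 (bookkeeping)] -/
theorem famB8OfRecordSubBP₂C_toGFData (β : ℝ) (len : B7Prop1Explicit.Site θ.D → ℝ) (j : IdxB8SubC θ) :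
    (famB8OfRecordSubBP₂C θ β len j).toGFData = (zdGF3P₂ θ.𝔸 θ.L β len j.1.1.1).toGFData := rfl

/-- `Cfg` ∕ `Pert` at the δ₂-member ARE the P-pin's at `j.1` (`rfl` ×2). [cite: Balaban1985RegularSpaces, (1.33)–(1.34) p.82 (bookkeeping)] -/
theorem famB8OfRecordSubBP₂C_Cfg_Pert (β : ℝ) (len : B7Prop1Explicit.Site θ.D → ℝ) (j : IdxB8SubC θ) :
    (famB8OfRecordSubBP₂C θ β len j).Cfg = (famB8OfRecordSubBP θ β len j.1).Cfg ∧ (famB8OfRecordSubBP₂C θ β len j).Pert = (famB8OfRecordSubBP θ β len j.1).Pert :=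
  ⟨rfl, rfl⟩

/-- Proposition 7's letters `InA` ∕ `C140` ∕ `InAAx` ∕ `avgClose` at the δ₂-member ARE the P-pin's at `j.1` (`rfl` ×4: Proposition 7 does not read (1.36)).
[cite: Balaban1985RegularSpaces, (1.139)–(1.145) p.100 (bookkeeping)] -/
theorem famB8OfRecordSubBP₂C_prop7Letters (β : ℝ) (len : B7Prop1Explicit.Site θ.D → ℝ) (j : IdxB8SubC θ) :
    (famB8OfRecordSubBP₂C θ β len j).InA = (famB8OfRecordSubBP θ β len j.1).InA ∧ (famB8OfRecordSubBP₂C θ β len j).C140 = (famB8OfRecordSubBP θ β len j.1).C140 ∧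
      (famB8OfRecordSubBP₂C θ β len j).InAAx = (famB8OfRecordSubBP θ β len j.1).InAAx ∧
        (famB8OfRecordSubBP₂C θ β len j).avgClose = (famB8OfRecordSubBP θ β len j.1).avgClose :=
  ⟨rfl, rfl, rfl, rfl⟩

/-- (1.37) ∕ (1.66) ∕ (1.146) `LandauF` ∕ (1.62) ∕ (1.39) ∕ (1.38) at the δ₂-member ARE the P-pin's at `j.1` (`rfl` ×6). [cite: Balaban1985RegularSpaces, (1.37)–(1.39) p.82, (1.62) p.87, (1.66) p.88, (1.146) p.101 (bookkeeping)] -/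
theorem famB8OfRecordSubBP₂C_C137_avgClose166_LandauF_C162_C139_Landau (β : ℝ) (len : B7Prop1Explicit.Site θ.D → ℝ) (j : IdxB8SubC θ) :
    (famB8OfRecordSubBP₂C θ β len j).C137 = (famB8OfRecordSubBP θ β len j.1).C137 ∧ (famB8OfRecordSubBP₂C θ β len j).avgClose166 = (famB8OfRecordSubBP θ β len j.1).avgClose166 ∧
      (famB8OfRecordSubBP₂C θ β len j).LandauF = (famB8OfRecordSubBP θ β len j.1).LandauF ∧ (famB8OfRecordSubBP₂C θ β len j).C162 = (famB8OfRecordSubBP θ β len j.1).C162 ∧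
        (famB8OfRecordSubBP₂C θ β len j).C139 = (famB8OfRecordSubBP θ β len j.1).C139 ∧ (famB8OfRecordSubBP₂C θ β len j).Landau = (famB8OfRecordSubBP θ β len j.1).Landau :=
  ⟨rfl, rfl, rfl, rfl, rfl, rfl⟩

/-- (1.36) at the δ₂-member IS `zdGF3P₂`'s letter (`rfl`) — the ONE field that differs from the P-pin. [cite: Balaban1985RegularSpaces, (1.36) p.82; Balaban1985BackgroundPropagators, (3.40) p.397] -/
theorem famB8OfRecordSubBP₂C_C136 (β : ℝ) (len : B7Prop1Explicit.Site θ.D → ℝ) (j : IdxB8SubC θ) :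
    (famB8OfRecordSubBP₂C θ β len j).C136 = (zdGF3P₂ θ.𝔸 θ.L β len j.1.1.1).C136 := rfl

/-- Theorem 8's source membership at the δ₂-member IS the H-pin's ∕ the P-pin's at `j.1` (`rfl`). [cite: Balaban1985RegularSpaces, Thm 8 (1.146) p.101 (bookkeeping)] -/
theorem famB8OfRecordSubBP₂C_InR (β : ℝ) (len : B7Prop1Explicit.Site θ.D → ℝ) (j : IdxB8SubC θ) :
    (famB8OfRecordSubBP₂C θ β len j).InR = (famB8OfRecordSubBP θ β len j.1).InR := rfl

/-- **The source membership «f ∈ R(U₀)» at a δ₂-member, unfolded** (`Iff.rfl`). [cite: Balaban1985RegularSpaces, Thm 8 (1.146) p.101, (1.27) p.80, p.86] -/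
theorem inR_famB8OfRecordSubBP₂C_iff (β : ℝ) (len : B7Prop1Explicit.Site θ.D → ℝ) (j : IdxB8SubC θ) (U₀ : (famB8OfRecordSubBP₂C θ β len j).Cfg)
    (f : B7Prop1Explicit.Site θ.D → θ.𝔸) :
    (famB8OfRecordSubBP₂C θ β len j).InR U₀ f ↔
      B8Eq138LandauZd.InR138 θ.L j.1.1.1.k j.1.1.1.η (j.1.1.1.Ω 0) (j.1.1.1.Λs j.1.1.1.k) U₀.1 f ∧ (∀ x, IsSelfAdjoint (f x)) ∧ (∀ x, x ∉ j.1.1.1.Ω 0 → f x = 0) ∧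
        B8ScaledSupNorm.Bdd θ.L j.1.1.1.k j.1.1.1.η (-(2 : ℝ)) (fun l (x : B7Prop1Explicit.Site θ.D) => x ∈ j.1.1.1.Ω l) f :=
  Iff.rfl

/-- **THE R-EXTENSION LAW `proj140` HOLDS AT THE δ₂-MEMBERS** (`proj140_famB8OfRecordSubBP` BY NAME: it reads (1.140) and (1.62) only, both unchanged).
[cite: Balaban1985RegularSpaces, (1.140) p.100, (1.62) p.87] -/
theorem proj140_famB8OfRecordSubBP₂C (β : ℝ) (len : B7Prop1Explicit.Site θ.D → ℝ) (j : IdxB8SubC θ) (α₂ : ℝ) (U₀ : (famB8OfRecordSubBP₂C θ β len j).Cfg)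
    (U₁ : (famB8OfRecordSubBP₂C θ β len j).Pert) (h : (famB8OfRecordSubBP₂C θ β len j).C140 α₂ U₀ U₁) : (famB8OfRecordSubBP₂C θ β len j).C162 1 α₂ U₀ U₁ :=
  proj140_famB8OfRecordSubBP β len j.1 α₂ U₀ U₁ h

/-- **THE CARRIER LAW (1.36) ⊂ (1.62) HOLDS AT THE δ₂-MEMBERS** (the first clause of the δ₂ letter is the P-pin's verbatim; (1.62) reads it only).
[cite: Balaban1985RegularSpaces, (1.36) p.82, (1.62) p.87] -/
theorem C136_C162_famB8OfRecordSubBP₂C (β : ℝ) (len : B7Prop1Explicit.Site θ.D → ℝ) (j : IdxB8SubC θ) (b b₂ s : ℝ) (U₀ : (famB8OfRecordSubBP₂C θ β len j).Cfg)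
    (U₁ : (famB8OfRecordSubBP₂C θ β len j).Pert) (h : (famB8OfRecordSubBP₂C θ β len j).C136 b b₂ s U₀ U₁) : (famB8OfRecordSubBP₂C θ β len j).C162 b s U₀ U₁ :=
  h.1

end FamilyP₂C

/-! ## §2. The δ₂-group of record substituted into a bundle (axial map PINNED); the slot in the `Prop7RepairedC C₇` currency; `rfl` faces -/

section SubIndexBP₂C

variable {θ : Stage3Params}

/-- **THE [B8] GROUP OF RECORD OVER THE ADMISSIBLE SUB-INDEX, READ AT THE δ₂-MEMBERS, substituted into a carrier bundle — WITH PROPOSITION 7's AXIAL MAP PINNED**: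
this seat's `withB8OfRecordSubBP` VERBATIM with `I8b := IdxB8SubC θ`, family `famB8OfRecordSubBP₂C`, and `toAxial8 := fun j => toAxialTowerResid θ λ.β λ.len j.1.1`
(print's tower-wise map in the type of the residual field — the layer's free `λ.toAxial` is NOT read); every other group of `X` unchanged.
[cite: Balaban1985RegularSpaces, Lemma 1 p.79 – Thm 8 p.101 (the carriers of the typed statements); Prop. 7 p.100 (the axial map); (1.3)–(1.4) p.77] -/
def _root_.Literature.MathematicalPhysics.QuantumFieldTheory.Balaban1983to89.DagBinding.PrintedCarriersR.withB8OfRecordSubBP₂C (X : PrintedCarriersR)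
    (θ : Stage3Params) (lam : ResidB8 θ) : PrintedCarriersR :=
  { X with
    I8a := B7Prop1Explicit.Site θ.D × Fin θ.D, I8b := IdxB8SubC θ, I8c := lam.I8c, I8d := lam.I8d, d8 := θ.D, L8 := θ.L,
    C₂ := lam.C₂, B₁' := lam.B₁', B₀' := lam.inp.B₀', B₁ := lam.B₁, B₂ := lam.B₂, c₁ := lam.c₁, inp8 := lam.inp, B₀β := lam.B₀β,
    loc8 := blockPairNA θ.D θ.L θ.𝔸, fam8 := fun j => (famB8OfRecordSubBP₂C θ lam.β lam.len j).toGFData2, lan8 := lam.lan, cub8 := lam.cub,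
    toAxial8 := fun j => toAxialTowerResid θ lam.β lam.len j.1.1,
    C140 := fun j => (famB8OfRecordSubBP₂C θ lam.β lam.len j).C140, InR := fun j => (famB8OfRecordSubBP₂C θ lam.β lam.len j).InR,
    proj140 := fun j α₂ U₀ U₁ h => proj140_famB8OfRecordSubBP₂C lam.β lam.len j α₂ U₀ U₁ h }

/-- **THE «P₂C» SLOT: the `b8` LEAF AT THE δ₂-GROUP OF RECORD OVER THE ADMISSIBLE SUB-FAMILY, IN ITS SURVIVING FORM AND IN THE `Prop7RepairedC C₇` CURRENCY, WITH
PROPOSITION 7's AXIAL MAP PINNED** (Lemma 1 p. 79, Thm 2 p. 83, Prop. 3 p. 87, Thm 4 p. 88, Prop. 5 p. 94, Prop. 6 p. 99, Prop. 7 p. 100 at `C₇ = 530·D·L²` for print's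
tower-wise map, Thm 8 p. 101 surviving at γ = 1 — (1.35) ∕ (1.66) ∕ (1.37) ∕ (1.145) in print's bond classes, (1.36)'s Hölder member on print's pair class, Theorem 8's
source space as printed). [cite: Balaban1985RegularSpaces, Lemma 1 p.79, Thm 2 p.83, Prop. 3 p.87, Thm 4 p.88, Prop. 5 p.94, Prop. 6 p.99, Prop. 7 p.100, Thm 8 (1.146) p.101 (surviving form, GAPS G-B8-13)] -/
def B8LeafOfRecordSubBP₂C (θ : Stage3Params) (lam : ResidB8 θ) : Prop :=
  B8LeafRSC θ.D (θ.L : ℝ) lam.C₂ lam.B₁' lam.inp.B₀' lam.B₁ lam.B₂ lam.c₁ lam.inp lam.B₀β (c₇OfRecord θ) (blockPairNA θ.D θ.L θ.𝔸)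
    (fun j : IdxB8SubC θ => famB8OfRecordSubBP₂C θ lam.β lam.len j) lam.lan lam.cub (fun j => toAxialTowerResid θ lam.β lam.len j.1.1)

/-- The `B8LeafRSC` leaf at `C₇ := c₇OfRecord θ` over the SUBSTITUTED bundle's own [B8] group IS `B8LeafOfRecordSubBP₂C θ lam` (`Iff.rfl`; the bundle carries no `C₇`,
it is supplied at the leaf). [cite: Balaban1985RegularSpaces, Lemma 1 – Thm 8 pp.79–101 (bookkeeping)] -/
theorem b8LeafRSC_withB8OfRecordSubBP₂C_iff (X : PrintedCarriersR) (θ : Stage3Params) (lam : ResidB8 θ) :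
    B8LeafRSC (X.withB8OfRecordSubBP₂C θ lam).d8 (X.withB8OfRecordSubBP₂C θ lam).L8 (X.withB8OfRecordSubBP₂C θ lam).C₂ (X.withB8OfRecordSubBP₂C θ lam).B₁'
        (X.withB8OfRecordSubBP₂C θ lam).B₀' (X.withB8OfRecordSubBP₂C θ lam).B₁ (X.withB8OfRecordSubBP₂C θ lam).B₂ (X.withB8OfRecordSubBP₂C θ lam).c₁
        (X.withB8OfRecordSubBP₂C θ lam).inp8 (X.withB8OfRecordSubBP₂C θ lam).B₀β (c₇OfRecord θ) (X.withB8OfRecordSubBP₂C θ lam).loc8 (X.withB8OfRecordSubBP₂C θ lam).fam8R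
        (X.withB8OfRecordSubBP₂C θ lam).lan8 (X.withB8OfRecordSubBP₂C θ lam).cub8 (X.withB8OfRecordSubBP₂C θ lam).toAxial8 ↔
      B8LeafOfRecordSubBP₂C θ lam :=
  Iff.rfl

/-- The substitution does not touch the [B10] group (`rfl`) … [cite: Balaban1985UV3, (1)–(5) p.256 (bookkeeping)] -/
theorem withB8OfRecordSubBP₂C_runs10 (X : PrintedCarriersR) (θ : Stage3Params) (lam : ResidB8 θ) : (X.withB8OfRecordSubBP₂C θ lam).runs10 = X.runs10 := rfl

/-- … nor the [B12 §§2–5] group (`rfl` ×2) … [cite: Balaban1987RG1, Lemma 4 p.280 (bookkeeping)] -/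
theorem withB8OfRecordSubBP₂C_F12_c12 (X : PrintedCarriersR) (θ : Stage3Params) (lam : ResidB8 θ) :
    (X.withB8OfRecordSubBP₂C θ lam).F12 = X.F12 ∧ (X.withB8OfRecordSubBP₂C θ lam).c12 = X.c12 := ⟨rfl, rfl⟩

/-- … nor the [B13] group (`rfl` ×2) … [cite: Balaban1988RG2Cluster, Lemmas 1–3 pp.9–20 (bookkeeping)] -/
theorem withB8OfRecordSubBP₂C_S13_c13 (X : PrintedCarriersR) (θ : Stage3Params) (lam : ResidB8 θ) :
    (X.withB8OfRecordSubBP₂C θ lam).S13 = X.S13 ∧ (X.withB8OfRecordSubBP₂C θ lam).c13 = X.c13 := ⟨rfl, rfl⟩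

/-- … commutes with the [B10] re-binding `withRuns10` (`rfl`) … [cite: Balaban1985UV3, (1)–(5) p.256 (bookkeeping)] -/
theorem withRuns10_withB8OfRecordSubBP₂C (X : PrintedCarriersR) {J : Type} (r : J → B10.RunData) (θ : Stage3Params) (lam : ResidB8 θ) :
    (X.withRuns10 r).withB8OfRecordSubBP₂C θ lam = (X.withB8OfRecordSubBP₂C θ lam).withRuns10 r := rfl

/-- … with the [B12] substitution `withB12` (`rfl`) … [cite: Balaban1987RG1, Lemma 4 p.280 (bookkeeping)] -/
theorem withB12_withB8OfRecordSubBP₂C (X : PrintedCarriersR) (F12 : B12Sec2to5.Lemma4Frame) (c12 : B12Sec2to5.Lemma4Consts) (θ : Stage3Params) (lam : ResidB8 θ) :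
    (X.withB12 F12 c12).withB8OfRecordSubBP₂C θ lam = (X.withB8OfRecordSubBP₂C θ lam).withB12 F12 c12 := rfl

/-- … and passes through the Stage-3 substitutions `carriers₃` (`rfl`). [cite: Balaban1984PropagatorsII, pp.223–250 (bookkeeping)] -/
theorem carriers₃_withB8OfRecordSubBP₂C (θ₃ : Stage3Params) (X : PrintedCarriersR) (θ : Stage3Params) (lam : ResidB8 θ) :
    carriers₃ θ₃ (X.withB8OfRecordSubBP₂C θ lam) = (carriers₃ θ₃ X).withB8OfRecordSubBP₂C θ lam := rfl

/-- The re-pin substitutes the `GFData2` family of the δ₂-carrier `zdGF3P₂` (`rfl`). [cite: Balaban1985RegularSpaces, (1.33)–(1.40) pp.82–83 (bookkeeping)] -/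
theorem withB8OfRecordSubBP₂C_fam8 (X : PrintedCarriersR) (θ : Stage3Params) (lam : ResidB8 θ) :
    (X.withB8OfRecordSubBP₂C θ lam).fam8 = fun j : IdxB8SubC θ => (zdGF3P₂ θ.𝔸 θ.L lam.β lam.len j.1.1.1).toGFData2 := rfl

/-- The re-pin's axial map IS print's tower-wise map at the member (`rfl`) — NOT the layer's free field. [cite: Balaban1985RegularSpaces, Prop. 7 p.100 (bookkeeping)] -/
theorem withB8OfRecordSubBP₂C_toAxial8 (X : PrintedCarriersR) (θ : Stage3Params) (lam : ResidB8 θ) :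
    (X.withB8OfRecordSubBP₂C θ lam).toAxial8 = fun j : IdxB8SubC θ => toAxialTowerResid θ lam.β lam.len j.1.1 := rfl

/-- Non-vacuity of the re-pin's index (`nonempty_idxB8SubC`). [cite: Balaban1985RegularSpaces, (1.131) p.99, (1.3)–(1.4) p.77] -/
theorem nonempty_I8b_withB8OfRecordSubBP₂C (X : PrintedCarriersR) (θ : Stage3Params) (lam : ResidB8 θ) : Nonempty (X.withB8OfRecordSubBP₂C θ lam).I8b :=
  nonempty_idxB8SubC θ

end SubIndexBP₂C

/-! ## §3. THE READING; the `p7` conjunct PROVED; the eight-field constructor; projections; RS-currency ⇒ the slot -/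

section ReadingP₂C

variable {θ : Stage3Params}

/-- ★ **PROPOSITION 7 HOLDS AT THE «P₂C» SLOT's DATA** — `B8Ineq145.Prop7RepairedC (c₇OfRecord θ)` over the admissible sub-family for print's tower-wise map, at every
`θ` with `θ.D ≥ 2`: this seat's `B8Prop7TowerAxialRecordP.prop7RepairedC_famB8OfRecordSubBP_toAxialTower_domainSeq` (p600262 v1.1) BY NAME — Proposition 7 does
not read (1.36), so the P-pin statement transports to the δ₂-members by `rfl` on the four letters it reads (n05-d's `prop7RepairedC_zdGF3HP₂_iff` pattern).
[cite: Balaban1985RegularSpaces, Prop. 7 (1.144)–(1.145) p.100, (1.3)–(1.4) p.77] -/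
theorem prop7_famB8OfRecordSubBP₂C (hD : 2 ≤ θ.D) (β : ℝ) (len : B7Prop1Explicit.Site θ.D → ℝ) :
    B8Ineq145.Prop7RepairedC (c₇OfRecord θ) (fun j : IdxB8SubC θ => famB8OfRecordSubBP₂C θ β len j) (fun j => toAxialTowerResid θ β len j.1.1) :=
  prop7RepairedC_famB8OfRecordSubBP_toAxialTower_domainSeq β len hD

/-- **THE READING OF THE «P₂C» SLOT**: `B8LeafOfRecordSubBP₂C θ λ` ⟺ (Lemma 1 ∧ Prop 5 ∃ ∧ Prop 5 ! ∧ Prop 6 — the four class-free conjuncts, letter for letter as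
before) ∧ (Thm 2 ∧ Prop 3 ∧ Thm 4 AT THE δ₂-MEMBERS' `GFData` ∕ `GFData2` ∧ Prop 7 in the repaired currency at `c₇OfRecord θ` for PRINT'S MAP ∧ Thm 8 surviving at γ = 1 AT
THE δ₂-MEMBERS) over the admissible sub-index. [cite: Balaban1985RegularSpaces, Lemma 1 p.79, Thm 2 p.83, Prop. 3 p.87, Thm 4 p.88, Prop. 5 p.94, Prop. 6 p.99, Prop. 7 p.100, Thm 8 (1.146) p.101] -/
theorem b8LeafOfRecordSubBP₂C_iff_classFree_and_P₂C (lam : ResidB8 θ) :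
    B8LeafOfRecordSubBP₂C θ lam ↔
      (B8.Lemma1Printed θ.D (blockPairNA θ.D θ.L θ.𝔸) ∧
        B8.Prop5Exists lam.inp.B₀' lam.B₁ lam.lan ∧ B8.Prop5Unique lam.lan ∧ B8.Prop6Printed θ.D (θ.L : ℝ) lam.B₁ lam.c₁ lam.cub) ∧
      (B8.Thm2Printed (fun j : IdxB8SubC θ => (zdGF3P₂ θ.𝔸 θ.L lam.β lam.len j.1.1.1).toGFData) ∧
        B8.Prop3Printed θ.D (θ.L : ℝ) lam.C₂ lam.inp lam.B₀β (fun j : IdxB8SubC θ => (zdGF3P₂ θ.𝔸 θ.L lam.β lam.len j.1.1.1).toGFData2) ∧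
        B8.Thm4Printed lam.B₁' (fun j : IdxB8SubC θ => (zdGF3P₂ θ.𝔸 θ.L lam.β lam.len j.1.1.1).toGFData) ∧
        B8Ineq145.Prop7RepairedC (c₇OfRecord θ) (fun j : IdxB8SubC θ => famB8OfRecordSubBP₂C θ lam.β lam.len j) (fun j => toAxialTowerResid θ lam.β lam.len j.1.1) ∧
        B8Thm8Surviving.Thm8SurvivingAt 1 lam.B₁ lam.B₂ (fun j : IdxB8SubC θ => famB8OfRecordSubBP₂C θ lam.β lam.len j)) :=
  ⟨fun h => ⟨⟨h.l1, h.p5e, h.p5u, h.p6⟩, ⟨h.t2, h.p3, h.t4, h.p7, h.t8⟩⟩,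
    fun ⟨⟨h1, h5e, h5u, h6⟩, ⟨h2, h3, h4, h7, h8⟩⟩ =>
      { l1 := h1, t2 := h2, p3 := h3, t4 := h4, p5e := h5e, p5u := h5u, p6 := h6, p7 := h7, t8 := h8 }⟩

/-- ★ **CONSTRUCTOR OF THE «P₂C» SLOT FROM EIGHT CONJUNCTS — `p7` IS SUPPLIED HERE** (`prop7_famB8OfRecordSubBP₂C`, `θ.D ≥ 2`): landed proofs of `l1 ∕ p5e ∕ p5u ∕ p6`
go in unchanged, `t2 ∕ p3 ∕ t4 ∕ t8` come from the δ₂ chain on `zdGF3P₂` ∕ `zdGF3HP₂` over the admissible sub-index.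
[cite: Balaban1985RegularSpaces, Lemma 1 – Prop. 7 pp.79–100, Thm 8 (1.146) p.101] -/
theorem b8LeafOfRecordSubBP₂C_of_fields (hD : 2 ≤ θ.D) (lam : ResidB8 θ) (l1 : B8.Lemma1Printed θ.D (blockPairNA θ.D θ.L θ.𝔸))
    (t2 : B8.Thm2Printed (fun j : IdxB8SubC θ => (zdGF3P₂ θ.𝔸 θ.L lam.β lam.len j.1.1.1).toGFData))
    (p3 : B8.Prop3Printed θ.D (θ.L : ℝ) lam.C₂ lam.inp lam.B₀β (fun j : IdxB8SubC θ => (zdGF3P₂ θ.𝔸 θ.L lam.β lam.len j.1.1.1).toGFData2))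
    (t4 : B8.Thm4Printed lam.B₁' (fun j : IdxB8SubC θ => (zdGF3P₂ θ.𝔸 θ.L lam.β lam.len j.1.1.1).toGFData))
    (p5e : B8.Prop5Exists lam.inp.B₀' lam.B₁ lam.lan) (p5u : B8.Prop5Unique lam.lan) (p6 : B8.Prop6Printed θ.D (θ.L : ℝ) lam.B₁ lam.c₁ lam.cub)
    (t8 : B8Thm8Surviving.Thm8SurvivingAt 1 lam.B₁ lam.B₂ (fun j : IdxB8SubC θ => famB8OfRecordSubBP₂C θ lam.β lam.len j)) :
    B8LeafOfRecordSubBP₂C θ lam :=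
  (b8LeafOfRecordSubBP₂C_iff_classFree_and_P₂C lam).2 ⟨⟨l1, p5e, p5u, p6⟩, ⟨t2, p3, t4, prop7_famB8OfRecordSubBP₂C hD lam.β lam.len, t8⟩⟩

/-- **RS-CURRENCY ⇒ THE SLOT** (`B8LeafKnitRSC.b8LeafRSC_of_b8LeafRS` at `2 ≤ c₇OfRecord θ`, under the monotonicity of (1.35) in its constant — `le_trans` on the
carrier's letter): the `B8LeafRS` leaf over the SAME pinned data (what a `Prop7PrintedR`-reading constructor would demand) implies `B8LeafOfRecordSubBP₂C`; never conversely.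
[cite: Balaban1985RegularSpaces, Prop. 7 (1.145) p.100, (1.35) p.82 (bookkeeping)] -/
theorem b8LeafOfRecordSubBP₂C_of_b8LeafRS_pinned (hD : 1 ≤ θ.D) (lam : ResidB8 θ)
    (h : B8LeafRS θ.D (θ.L : ℝ) lam.C₂ lam.B₁' lam.inp.B₀' lam.B₁ lam.B₂ lam.c₁ lam.inp lam.B₀β (blockPairNA θ.D θ.L θ.𝔸)
      (fun j : IdxB8SubC θ => famB8OfRecordSubBP₂C θ lam.β lam.len j) lam.lan lam.cub (fun j => toAxialTowerResid θ lam.β lam.len j.1.1)) :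
    B8LeafOfRecordSubBP₂C θ lam :=
  B8LeafKnitRSC.b8LeafRSC_of_b8LeafRS (two_le_c₇OfRecord θ hD)
    (fun _ _ _ _ _ haa' ha l hl z μ hend => (ha l hl z μ hend).trans haa') h

/-- The Theorem-8 conjunct of the slot, projected (the target of n05-d's δ₂ Thm-8 chain on `zdGF3HP₂` at `ι := (·.1.1.1)`). [cite: Balaban1985RegularSpaces, Thm 8 (1.146) p.101] -/
theorem B8LeafOfRecordSubBP₂C.t8HP₂ {lam : ResidB8 θ} (h : B8LeafOfRecordSubBP₂C θ lam) :
    B8Thm8Surviving.Thm8SurvivingAt 1 lam.B₁ lam.B₂ (fun j : IdxB8SubC θ => zdGF3HP₂ θ.𝔸 θ.L lam.β lam.len j.1.1.1) :=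
  h.t8

/-- The Proposition-3 conjunct of the slot, projected on the `GFData2` family of `zdGF3P₂`. [cite: Balaban1985RegularSpaces, Prop. 3 p.87] -/
theorem B8LeafOfRecordSubBP₂C.p3P₂ {lam : ResidB8 θ} (h : B8LeafOfRecordSubBP₂C θ lam) :
    B8.Prop3Printed θ.D (θ.L : ℝ) lam.C₂ lam.inp lam.B₀β (fun j : IdxB8SubC θ => (zdGF3P₂ θ.𝔸 θ.L lam.β lam.len j.1.1.1).toGFData2) :=
  h.p3

/-- The Theorem-4 conjunct of the slot, projected. [cite: Balaban1985RegularSpaces, Thm 4 p.88] -/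
theorem B8LeafOfRecordSubBP₂C.t4P₂ {lam : ResidB8 θ} (h : B8LeafOfRecordSubBP₂C θ lam) :
    B8.Thm4Printed lam.B₁' (fun j : IdxB8SubC θ => (zdGF3P₂ θ.𝔸 θ.L lam.β lam.len j.1.1.1).toGFData) :=
  h.t4

/-- The Theorem-2 conjunct of the slot, projected. [cite: Balaban1985RegularSpaces, Thm 2 p.83] -/
theorem B8LeafOfRecordSubBP₂C.t2P₂ {lam : ResidB8 θ} (h : B8LeafOfRecordSubBP₂C θ lam) :
    B8.Thm2Printed (fun j : IdxB8SubC θ => (zdGF3P₂ θ.𝔸 θ.L lam.β lam.len j.1.1.1).toGFData) :=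
  h.t2

/-- The Proposition-7 conjunct of the slot, projected (always available: `prop7_famB8OfRecordSubBP₂C`). [cite: Balaban1985RegularSpaces, Prop. 7 p.100] -/
theorem B8LeafOfRecordSubBP₂C.p7C {lam : ResidB8 θ} (h : B8LeafOfRecordSubBP₂C θ lam) :
    B8Ineq145.Prop7RepairedC (c₇OfRecord θ) (fun j : IdxB8SubC θ => famB8OfRecordSubBP₂C θ lam.β lam.len j) (fun j => toAxialTowerResid θ lam.β lam.len j.1.1) :=
  B8LeafRSC.p7 h

end ReadingP₂C

/-! ## §4. The CUT residual layer (n05-d's `ResidB8.cutSubB`): the slot there reads the knits' conclusion at the δ₂-members -/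

section CutLayerP₂C

variable {θ : Stage3Params}

/-- **THE SLOT AT THE CUT LAYER READS THE KNITS' CONCLUSION LETTER FOR LETTER** (`Iff.rfl`): `B8LeafOfRecordSubBP₂C θ (λ.cutSubB J lan c₁)` is the `B8LeafRSC` leaf at
`c₇OfRecord θ` over `famB8OfRecordSubBP₂C θ λ.β λ.len`, Prop. 5 at `lan`, Prop. 6 at `fun j : IdxB8SubB θ => cubB8OfRecord θ j.1`, print's axial map, threshold `c₁`
(the cut touches neither `β, len` nor the pinned map). [cite: Balaban1985RegularSpaces, Lemma 1 – Thm 8 pp.79–101 (bookkeeping)] -/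
theorem b8LeafOfRecordSubBP₂C_cutSubB_iff (lam : ResidB8 θ) (J : Type) (lan : J → B8.LandauData) (c₁ : ℝ) :
    B8LeafOfRecordSubBP₂C θ (lam.cutSubB J lan c₁) ↔
      B8LeafRSC θ.D (θ.L : ℝ) lam.C₂ lam.B₁' lam.inp.B₀' lam.B₁ lam.B₂ c₁ lam.inp lam.B₀β (c₇OfRecord θ) (blockPairNA θ.D θ.L θ.𝔸)
        (fun j : IdxB8SubC θ => famB8OfRecordSubBP₂C θ lam.β lam.len j) lan (fun j : IdxB8SubB θ => cubB8OfRecord θ j.1)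
        (fun j => toAxialTowerResid θ lam.β lam.len j.1.1) :=
  Iff.rfl

/-- **THE SLOT AT THE CUT LAYER, READ** (the reading §3 at the cut layer). [cite: Balaban1985RegularSpaces, Lemma 1 – Thm 8 pp.79–101 (bookkeeping)] -/
theorem b8LeafOfRecordSubBP₂C_cutSubB_iff_classFree_and_P₂C (lam : ResidB8 θ) (J : Type) (lan : J → B8.LandauData) (c₁ : ℝ) :
    B8LeafOfRecordSubBP₂C θ (lam.cutSubB J lan c₁) ↔
      (B8.Lemma1Printed θ.D (blockPairNA θ.D θ.L θ.𝔸) ∧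
        B8.Prop5Exists lam.inp.B₀' lam.B₁ lan ∧ B8.Prop5Unique lan ∧
        B8.Prop6Printed θ.D (θ.L : ℝ) lam.B₁ c₁ (fun j : IdxB8SubB θ => cubB8OfRecord θ j.1)) ∧
      (B8.Thm2Printed (fun j : IdxB8SubC θ => (zdGF3P₂ θ.𝔸 θ.L lam.β lam.len j.1.1.1).toGFData) ∧
        B8.Prop3Printed θ.D (θ.L : ℝ) lam.C₂ lam.inp lam.B₀β (fun j : IdxB8SubC θ => (zdGF3P₂ θ.𝔸 θ.L lam.β lam.len j.1.1.1).toGFData2) ∧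
        B8.Thm4Printed lam.B₁' (fun j : IdxB8SubC θ => (zdGF3P₂ θ.𝔸 θ.L lam.β lam.len j.1.1.1).toGFData) ∧
        B8Ineq145.Prop7RepairedC (c₇OfRecord θ) (fun j : IdxB8SubC θ => famB8OfRecordSubBP₂C θ lam.β lam.len j) (fun j => toAxialTowerResid θ lam.β lam.len j.1.1) ∧
        B8Thm8Surviving.Thm8SurvivingAt 1 lam.B₁ lam.B₂ (fun j : IdxB8SubC θ => famB8OfRecordSubBP₂C θ lam.β lam.len j)) :=
  b8LeafOfRecordSubBP₂C_iff_classFree_and_P₂C (lam.cutSubB J lan c₁)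

/-- **THE SLOT AT THE CUT LAYER FROM SEVEN CONJUNCTS** (`p7` supplied; the cut layer's `p5e p5u p6` at `lan` ∕ the law-cut cubes ∕ `c₁`). [cite: Balaban1985RegularSpaces, Lemma 1 – Thm 8 pp.79–101 (bookkeeping)] -/
theorem b8LeafOfRecordSubBP₂C_cutSubB_of_fields (hD : 2 ≤ θ.D) (lam : ResidB8 θ) (J : Type) (lan : J → B8.LandauData) (c₁ : ℝ)
    (l1 : B8.Lemma1Printed θ.D (blockPairNA θ.D θ.L θ.𝔸))
    (t2 : B8.Thm2Printed (fun j : IdxB8SubC θ => (zdGF3P₂ θ.𝔸 θ.L lam.β lam.len j.1.1.1).toGFData))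
    (p3 : B8.Prop3Printed θ.D (θ.L : ℝ) lam.C₂ lam.inp lam.B₀β (fun j : IdxB8SubC θ => (zdGF3P₂ θ.𝔸 θ.L lam.β lam.len j.1.1.1).toGFData2))
    (t4 : B8.Thm4Printed lam.B₁' (fun j : IdxB8SubC θ => (zdGF3P₂ θ.𝔸 θ.L lam.β lam.len j.1.1.1).toGFData))
    (p5e : B8.Prop5Exists lam.inp.B₀' lam.B₁ lan) (p5u : B8.Prop5Unique lan)
    (p6 : B8.Prop6Printed θ.D (θ.L : ℝ) lam.B₁ c₁ (fun j : IdxB8SubB θ => cubB8OfRecord θ j.1))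
    (t8 : B8Thm8Surviving.Thm8SurvivingAt 1 lam.B₁ lam.B₂ (fun j : IdxB8SubC θ => famB8OfRecordSubBP₂C θ lam.β lam.len j)) :
    B8LeafOfRecordSubBP₂C θ (lam.cutSubB J lan c₁) :=
  b8LeafOfRecordSubBP₂C_of_fields hD (lam.cutSubB J lan c₁) l1 t2 p3 t4 p5e p5u p6 t8

end CutLayerP₂C


end Literature.MathematicalPhysics.QuantumFieldTheory.Balaban1983to89.Node00

end
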